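import Literature.MathematicalPhysics.QuantumManyBody.CLYKernelFourier
import Literature.MathematicalPhysics.QuantumManyBody.SlidingLemmaJellium
import Mathlib.Analysis.Calculus.ContDiff.Convolution
import Mathlib.Analysis.Distribution.SchwartzSpace.Fourier
import HarnessLib

/-!
# The Conlon–Lieb–Yau decomposition `|x|⁻¹ = F + h·Y_ω` with `F` of positive type

Topic `Literature/MathematicalPhysics/QuantumManyBody` (electrostatics groundwork for the charged
Bose gas, `JelliumBoseGas.foldyLaw`). This file completes the analytic input of the sliding method
— [ConlonLiebYau1988, Lemma 2.1] in the case `ν = 0` used by [LiebSolovej2001, Lemma 3.1] and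
[LSSY2005, Thm. 10.5] — and thereby makes the sliding lemmas of `SlidingLemma.lean` /
`SlidingLemmaJellium.lean` unconditional.

**Part A (the limit `ν → 0`).** For a cutoff `h` (continuous, integrable, even, `h(0) = 1`,
`𝓕h ∈ L¹` with the moment `(1+|q|²)⁴ Re𝓕h ∈ L¹`) and `m ≥ 1` put `η = Re 𝓕h`,
`Φ₀(p) = 1/(π|p|²) - ∫ η(q) 4π/(4π²|p-q|²+m) dq` (the `n = 0` member of the family `Φ_n` of
`CLYKernelFourier.lean`). Letting `n → 0⁺` in `Y_n - hY_m = ∫ Φ_n cos` (dominated convergence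
with the `n`-uniform majorant of `Coulomb.abs_clyPhi_le`) gives, for `z ≠ 0`,
`|z|⁻¹ - h(z) e^{-√m|z|}/|z| = ∫ Φ₀(p) cos(2π⟨p, z⟩) dp`, `Φ₀ ∈ L¹`; `Φ₀ ≥ 0` off the origin as
soon as `Φ₁ ≥ 0` (`Coulomb.clyPhi_nonneg`); and if `Dh(0) = 0` then letting `z → 0` gives
`∫ Φ₀ = √m` ("`lim_{x→0} F(x) = ω`" in [LiebSolovej2001, proof of Lemma 3.1]).

**Part B (the cutoff `h = γ χ ∗ χ(-·)`).** For `χ ∈ C_c^∞(ℝ³)` real with `∫χ² ≠ 0` and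
`γ = (∫χ²)⁻¹`, the function `h(z) = γ ∫ χ(u)χ(u - z) du` is smooth, compactly supported, even,
`h(0) = 1`, `Dh(0) = 0`, and (being Schwartz) has `𝓕h` Schwartz, so all hypotheses of Part A
hold; the constants `A, B` of `Coulomb.cly_fourier_positivity` are finite. Hence:

* `Coulomb.cly_coulomb_decomposition` — **[ConlonLiebYau1988, Lemma 2.1] (`ν = 0`)**: there is
  `ω₀ = ω₀(χ) > 0` such that for every `ω ≥ ω₀` there is `Φ ≥ 0` measurable and integrable with
  `∫ Φ = ω` and `|z|⁻¹ = ∫ Φ(p)cos(2π⟨p,z⟩)dp + h(z) e^{-ω|z|}/|z|` for all `z ≠ 0`.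
* `Coulomb.cly_point_charges` — the CLY inequality `∑_{i<j} eᵢeⱼ (|xᵢ-xⱼ|⁻¹ - hY_ω(xᵢ-xⱼ))
  ≥ -½ ω ∑ eᵢ²`.
* `Coulomb.sliding_lemma_pp_cly`, `Coulomb.sliding_lemma_jellium_cly` — the sliding lemmas
  [LSSY2005, Thm. 10.5], [LiebSolovej2001, Lemma 3.1] (scale `ℓ = 1`) with the CLY hypothesis
  discharged: only `χ ∈ C_c^∞`, `∫χ² ≠ 0` and `ω ≥ ω₀(χ)` remain.

We work with `C^∞` cutoffs (the source needs `C⁴`; the cruder Taylor bound of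
`CLYFourierPositivity.lean` uses moments of `𝓕h` of order 8).
-- TODO(general form): `ν > 0` and `C⁴` cutoffs as in [ConlonLiebYau1988, Lemma 2.1].

## References

* [ConlonLiebYau1988] J. G. Conlon, E. H. Lieb, H.-T. Yau, *The N^{7/5} law for charged bosons*,
  Commun. Math. Phys. 116 (1988) 417–448, Lemma 2.1.
* [LiebSolovej2001] E. H. Lieb, J. P. Solovej, Commun. Math. Phys. 217 (2001) 127–163, Lemma 3.1
  (arXiv:cond-mat/0007425, p. 8).
* [LSSY2005] E. H. Lieb, R. Seiringer, J. P. Solovej, J. Yngvason, *The Mathematics of the Bose Gas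
  and its Condensation* (2005), Thm. 10.5 and the remark following it.
-/

noncomputable section

open MeasureTheory Set Filter Real
open scoped ENNReal NNReal Topology FourierTransform InnerProductSpace Convolution

namespace Literature.MathematicalPhysics.QuantumManyBody.Coulomb

open BoseGas Literature.Analysis.UnboundedOperators

/-! ### Part A: the limit `n → 0⁺` -/

section PartA

variable {h : Space → ℝ}

/-- Lebesgue-almost every point of `ℝ³` is nonzero. [folklore] -/
theorem ae_ne_zero_space : ∀ᵐ p : Space ∂volume, p ≠ 0 := by
  have : (volume : Measure Space) {p | ¬p ≠ 0} = 0 := by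
    simp only [ne_eq, not_not, setOf_eq_eq_singleton, measure_singleton]
  exact ae_iff.2 this

/-- The smeared Yukawa symbol `p ↦ ∫ Re𝓕h(q) 4π/(4π²|p-q|²+m) dq` is continuous (it is
`4π/(4π²|p|²+1) - Φ₁(p)`). [folklore] -/
theorem continuous_clyConv (hhc : Continuous h) (hhi : Integrable h)
    (hH : Integrable (𝓕 (fun x : Space => (h x : ℂ)))) (heven : ∀ x, h (-x) = h x) {m : ℝ}
    (hm : 0 < m) :
    Continuous fun p : Space =>
      ∫ q, (𝓕 (fun x : Space => (h x : ℂ)) q).re * (4 * π / (4 * π ^ 2 * ‖p - q‖ ^ 2 + m)) := by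
  have h1 := continuous_clyPhi hhc hhi hH heven hm one_pos
  have h2 : Continuous fun p : Space => 4 * π / (4 * π ^ 2 * ‖p‖ ^ 2 + 1) :=
    continuous_const.div ((continuous_const.mul (continuous_norm.pow 2)).add continuous_const)
      fun p => by positivity
  exact (h2.sub h1).congr fun p => sub_sub_cancel _ _

/-- `Φ₀` is measurable. [folklore] -/
theorem measurable_clyPhi_zero (hhc : Continuous h) (hhi : Integrable h)
    (hH : Integrable (𝓕 (fun x : Space => (h x : ℂ)))) (heven : ∀ x, h (-x) = h x) {m : ℝ}
    (hm : 0 < m) :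
    Measurable fun p : Space => 4 * π / (4 * π ^ 2 * ‖p‖ ^ 2) -
      ∫ q, (𝓕 (fun x : Space => (h x : ℂ)) q).re * (4 * π / (4 * π ^ 2 * ‖p - q‖ ^ 2 + m)) :=
  (measurable_const.div (measurable_const.mul (measurable_norm.pow_const _))).sub
    (continuous_clyConv hhc hhi hH heven hm).measurable

/-- **Monotonicity in `n`**: `Φ_n(p) ≤ Φ₀(p)` for `p ≠ 0`, `n ≥ 0`. [folklore] -/
theorem clyPhi_le_clyPhi_zero (h : Space → ℝ) (m : ℝ) {n : ℝ} (hn : 0 ≤ n) {p : Space}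
    (hp : p ≠ 0) :
    4 * π / (4 * π ^ 2 * ‖p‖ ^ 2 + n) -
        ∫ q, (𝓕 (fun x : Space => (h x : ℂ)) q).re * (4 * π / (4 * π ^ 2 * ‖p - q‖ ^ 2 + m)) ≤
      4 * π / (4 * π ^ 2 * ‖p‖ ^ 2) -
        ∫ q, (𝓕 (fun x : Space => (h x : ℂ)) q).re * (4 * π / (4 * π ^ 2 * ‖p - q‖ ^ 2 + m)) := by
  have hp' : 0 < ‖p‖ := norm_pos_iff.2 hp
  have hπ : 0 < π := Real.pi_pos
  refine sub_le_sub_right (div_le_div_of_nonneg_left (by positivity) (by positivity) ?_) _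
  linarith

/-- **`Φ₀ ≥ 0` off the origin** when `Φ₁ ≥ 0` [ConlonLiebYau1988, Lemma 2.1]: under the
positivity hypotheses of `clyPhi_nonneg` with `m - 1` in place of `m - n`.
[cite: ConlonLiebYau1988, Lemma 2.1] -/
theorem clyPhi_zero_nonneg (hhc : Continuous h) (hhi : Integrable h)
    (hH : Integrable (𝓕 (fun x : Space => (h x : ℂ)))) (heven : ∀ x, h (-x) = h x) (hh0 : h 0 = 1)
    (hmom : Integrable fun q : Space => (1 + ‖q‖ ^ 2) ^ 4 * (𝓕 (fun x : Space => (h x : ℂ)) q).re)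
    {m : ℝ} (hm : 4 * π ^ 2 ≤ m)
    (hA : 32 * π ^ 2 * (∫ q, (6 * ‖q‖ ^ 2 + 4 * π ^ 2 * ‖q‖ ^ 4) *
      |(𝓕 (fun x : Space => (h x : ℂ)) q).re|) + 1 ≤ m)
    (hB : 16 * π ^ 2 * (∫ q, (6 * ‖q‖ ^ 2 + 4 * π ^ 2 * ‖q‖ ^ 4) * (1 + 4 * ‖q‖ ^ 2) ^ 2 *
      |(𝓕 (fun x : Space => (h x : ℂ)) q).re|) + 1 ≤ m) {p : Space} (hp : p ≠ 0) :
    0 ≤ 4 * π / (4 * π ^ 2 * ‖p‖ ^ 2) -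
      ∫ q, (𝓕 (fun x : Space => (h x : ℂ)) q).re * (4 * π / (4 * π ^ 2 * ‖p - q‖ ^ 2 + m)) :=
  (clyPhi_nonneg hhc hhi hH heven hh0 hmom hm one_pos (by linarith) (by linarith) p).trans
    (clyPhi_le_clyPhi_zero h m zero_le_one hp)

/-- **The `n`-uniform integrable majorant**: for `m ≥ 1`, `0 ≤ n ≤ m` and `p ≠ 0`,
`|Φ_n(p)| ≤ G₀(p) := (1/(π|p|²) - 4π/(4π²|p|²+m)) + 64π³A/(4π²|p|²+m)² + 16π³B/(m²(1+|p|²)²)`.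
[cite: ConlonLiebYau1988, Lemma 2.1 (proof)] -/
theorem abs_clyPhi_le_majorant (hhc : Continuous h) (hhi : Integrable h)
    (hH : Integrable (𝓕 (fun x : Space => (h x : ℂ)))) (heven : ∀ x, h (-x) = h x) (hh0 : h 0 = 1)
    (hmom : Integrable fun q : Space => (1 + ‖q‖ ^ 2) ^ 4 * (𝓕 (fun x : Space => (h x : ℂ)) q).re)
    {m n : ℝ} (hm1 : 1 ≤ m) (hn : 0 ≤ n) (hnm : n ≤ m) {p : Space} (hp : p ≠ 0) :
    |4 * π / (4 * π ^ 2 * ‖p‖ ^ 2 + n) -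
        ∫ q, (𝓕 (fun x : Space => (h x : ℂ)) q).re * (4 * π / (4 * π ^ 2 * ‖p - q‖ ^ 2 + m))| ≤
      (4 * π / (4 * π ^ 2 * ‖p‖ ^ 2) - 4 * π / (4 * π ^ 2 * ‖p‖ ^ 2 + m)) +
        (64 * π ^ 3 * (∫ q, (6 * ‖q‖ ^ 2 + 4 * π ^ 2 * ‖q‖ ^ 4) *
            |(𝓕 (fun x : Space => (h x : ℂ)) q).re|) * (1 / (4 * π ^ 2 * ‖p‖ ^ 2 + m) ^ 2) +
          16 * π ^ 3 * (∫ q, (6 * ‖q‖ ^ 2 + 4 * π ^ 2 * ‖q‖ ^ 4) * (1 + 4 * ‖q‖ ^ 2) ^ 2 *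
            |(𝓕 (fun x : Space => (h x : ℂ)) q).re|) / m ^ 2 * (1 / (1 + ‖p‖ ^ 2) ^ 2)) := by
  have hp' : 0 < ‖p‖ := norm_pos_iff.2 hp
  have hπ : 0 < π := Real.pi_pos
  have h1 := abs_clyPhi_le hhc hhi hH heven hh0 hmom hm1 hnm p (by positivity)
  have h2 : 4 * π / (4 * π ^ 2 * ‖p‖ ^ 2 + n) ≤ 4 * π / (4 * π ^ 2 * ‖p‖ ^ 2) :=
    div_le_div_of_nonneg_left (by positivity) (by positivity) (by linarith)
  linarith

/-- The majorant `G₀` is integrable on `ℝ³`. [folklore] -/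
theorem integrable_clyMajorant (h : Space → ℝ) {m : ℝ} (hm : 0 < m) :
    Integrable fun p : Space =>
      (4 * π / (4 * π ^ 2 * ‖p‖ ^ 2) - 4 * π / (4 * π ^ 2 * ‖p‖ ^ 2 + m)) +
        (64 * π ^ 3 * (∫ q, (6 * ‖q‖ ^ 2 + 4 * π ^ 2 * ‖q‖ ^ 4) *
            |(𝓕 (fun x : Space => (h x : ℂ)) q).re|) * (1 / (4 * π ^ 2 * ‖p‖ ^ 2 + m) ^ 2) +
          16 * π ^ 3 * (∫ q, (6 * ‖q‖ ^ 2 + 4 * π ^ 2 * ‖q‖ ^ 4) * (1 + 4 * ‖q‖ ^ 2) ^ 2 *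
            |(𝓕 (fun x : Space => (h x : ℂ)) q).re|) / m ^ 2 * (1 / (1 + ‖p‖ ^ 2) ^ 2)) := by
  have hπ : 0 < π := Real.pi_pos
  have h1 := integrable_yukawaSymbol_sub (le_refl (0 : ℝ)) hm.le hm
  simp only [add_zero] at h1
  exact h1.add (((integrable_inv_quadratic_sq hm (by positivity : (0 : ℝ) < 4 * π ^ 2)).const_mul
    _).add (integrable_inv_one_add_normSq_sq.const_mul _))

/-- **`Φ₀` is integrable** (`m ≥ 1`). [cite: ConlonLiebYau1988, Lemma 2.1] -/
theorem integrable_clyPhi_zero (hhc : Continuous h) (hhi : Integrable h)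
    (hH : Integrable (𝓕 (fun x : Space => (h x : ℂ)))) (heven : ∀ x, h (-x) = h x) (hh0 : h 0 = 1)
    (hmom : Integrable fun q : Space => (1 + ‖q‖ ^ 2) ^ 4 * (𝓕 (fun x : Space => (h x : ℂ)) q).re)
    {m : ℝ} (hm1 : 1 ≤ m) :
    Integrable fun p : Space => 4 * π / (4 * π ^ 2 * ‖p‖ ^ 2) -
      ∫ q, (𝓕 (fun x : Space => (h x : ℂ)) q).re * (4 * π / (4 * π ^ 2 * ‖p - q‖ ^ 2 + m)) := by
  have hm0 : 0 < m := by linarith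
  refine (integrable_clyMajorant h hm0).mono'
    (measurable_clyPhi_zero hhc hhi hH heven hm0).aestronglyMeasurable ?_
  filter_upwards [ae_ne_zero_space] with p hp
  rw [Real.norm_eq_abs]
  have := abs_clyPhi_le_majorant hhc hhi hH heven hh0 hmom hm1 le_rfl hm0.le hp (n := 0)
  simpa only [add_zero] using this

/-- **The Coulomb potential minus the smeared Yukawa potential as a cosine integral**
[ConlonLiebYau1988, Lemma 2.1, `ν = 0`; LiebSolovej2001, Lemma 3.1 (proof)]: for `h` continuous,
integrable, even, `h(0) = 1`, with `𝓕h ∈ L¹` and `(1+|q|²)⁴Re𝓕h ∈ L¹`, and `m ≥ 1`, for every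
`z ≠ 0`,
`|z|⁻¹ - h(z) e^{-√m|z|}/|z| = ∫ Φ₀(p) cos(2π⟨p, z⟩) dp` — the limit `n → 0⁺` of
`Coulomb.clyKernel_eq_integral_clyPhi_cos` by dominated convergence.
[cite: ConlonLiebYau1988, Lemma 2.1] -/
theorem coulomb_sub_smearedYukawa_eq_integral_cos (hhc : Continuous h) (hhi : Integrable h)
    (hH : Integrable (𝓕 (fun x : Space => (h x : ℂ)))) (heven : ∀ x, h (-x) = h x) (hh0 : h 0 = 1)
    (hmom : Integrable fun q : Space => (1 + ‖q‖ ^ 2) ^ 4 * (𝓕 (fun x : Space => (h x : ℂ)) q).re)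
    {m : ℝ} (hm1 : 1 ≤ m) {z : Space} (hz : z ≠ 0) :
    ‖z‖⁻¹ - h z * (Real.exp (-(Real.sqrt m * ‖z‖)) / ‖z‖) =
      ∫ p, (4 * π / (4 * π ^ 2 * ‖p‖ ^ 2) -
        ∫ q, (𝓕 (fun x : Space => (h x : ℂ)) q).re * (4 * π / (4 * π ^ 2 * ‖p - q‖ ^ 2 + m))) *
          Real.cos (2 * π * ⟪p, z⟫_ℝ) := by
  have hm0 : 0 < m := by linarith
  have hπ : 0 < π := Real.pi_pos
  have hIoc : ∀ᶠ n in 𝓝[>] (0 : ℝ), n ∈ Ioc (0 : ℝ) 1 := Ioc_mem_nhdsGT zero_lt_one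
  -- the left-hand sides converge
  have hL : Tendsto (fun n : ℝ => Real.exp (-(Real.sqrt n * ‖z‖)) / ‖z‖ -
      h z * (Real.exp (-(Real.sqrt m * ‖z‖)) / ‖z‖)) (𝓝[>] 0)
      (𝓝 (‖z‖⁻¹ - h z * (Real.exp (-(Real.sqrt m * ‖z‖)) / ‖z‖))) := by
    refine Tendsto.sub ?_ tendsto_const_nhds
    have hc : Continuous fun n : ℝ => Real.exp (-(Real.sqrt n * ‖z‖)) / ‖z‖ :=
      (Real.continuous_exp.comp (Real.continuous_sqrt.mul continuous_const).neg).div_const _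
    have := (hc.tendsto 0).mono_left (nhdsWithin_le_nhds (s := Ioi (0 : ℝ)))
    simpa using this
  -- the right-hand sides converge (dominated convergence)
  have hR : Tendsto (fun n : ℝ => ∫ p, (4 * π / (4 * π ^ 2 * ‖p‖ ^ 2 + n) -
      ∫ q, (𝓕 (fun x : Space => (h x : ℂ)) q).re * (4 * π / (4 * π ^ 2 * ‖p - q‖ ^ 2 + m))) *
        Real.cos (2 * π * ⟪p, z⟫_ℝ)) (𝓝[>] 0)
      (𝓝 (∫ p, (4 * π / (4 * π ^ 2 * ‖p‖ ^ 2) -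
        ∫ q, (𝓕 (fun x : Space => (h x : ℂ)) q).re * (4 * π / (4 * π ^ 2 * ‖p - q‖ ^ 2 + m))) *
          Real.cos (2 * π * ⟪p, z⟫_ℝ))) := by
    have hcos : Continuous fun p : Space => Real.cos (2 * π * ⟪p, z⟫_ℝ) :=
      Real.continuous_cos.comp (continuous_const.mul (continuous_id.inner continuous_const))
    refine tendsto_integral_filter_of_dominated_convergence _ ?_ ?_ (integrable_clyMajorant h hm0) ?_
    · filter_upwards [hIoc] with n hn
      exact ((continuous_clyPhi hhc hhi hH heven hm0 hn.1).mul hcos).aestronglyMeasurable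
    · filter_upwards [hIoc] with n hn
      filter_upwards [ae_ne_zero_space] with p hp
      rw [norm_mul, Real.norm_eq_abs, Real.norm_eq_abs]
      refine (mul_le_of_le_one_right (abs_nonneg _) (Real.abs_cos_le_one _)).trans ?_
      exact abs_clyPhi_le_majorant hhc hhi hH heven hh0 hmom hm1 hn.1.le (hn.2.trans hm1) hp
    · filter_upwards [ae_ne_zero_space] with p hp
      have hp' : 0 < ‖p‖ := norm_pos_iff.2 hp
      refine Tendsto.mul ?_ tendsto_const_nhds
      refine Tendsto.sub ?_ tendsto_const_nhds
      have ht : Tendsto (fun n : ℝ => 4 * π / (4 * π ^ 2 * ‖p‖ ^ 2 + n)) (𝓝 0)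
          (𝓝 (4 * π / (4 * π ^ 2 * ‖p‖ ^ 2 + 0))) :=
        tendsto_const_nhds.div (tendsto_const_nhds.add tendsto_id)
          (by rw [add_zero]; positivity)
      rw [add_zero] at ht
      exact ht.mono_left nhdsWithin_le_nhds
  -- the two sides agree for `0 < n ≤ 1`
  have hEq : ∀ᶠ n in 𝓝[>] (0 : ℝ), Real.exp (-(Real.sqrt n * ‖z‖)) / ‖z‖ -
      h z * (Real.exp (-(Real.sqrt m * ‖z‖)) / ‖z‖) =
      ∫ p, (4 * π / (4 * π ^ 2 * ‖p‖ ^ 2 + n) -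
        ∫ q, (𝓕 (fun x : Space => (h x : ℂ)) q).re * (4 * π / (4 * π ^ 2 * ‖p - q‖ ^ 2 + m))) *
          Real.cos (2 * π * ⟪p, z⟫_ℝ) := by
    filter_upwards [hIoc] with n hn
    exact clyKernel_eq_integral_clyPhi_cos hhc hhi hH heven hh0 hmom hm1 hn.1 (hn.2.trans hm1) hz
  exact tendsto_nhds_unique_of_eventuallyEq hL hR hEq

/-- **`∫ Φ₀ = √m`** ("`lim_{x → 0} F(x) = ω`", [LiebSolovej2001, proof of Lemma 3.1]): under the
hypotheses of `coulomb_sub_smearedYukawa_eq_integral_cos`, if moreover `Dh(0) = 0` then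
`∫ Φ₀ = √m` — let `z → 0` in the cosine representation: the right side tends to `∫ Φ₀`
(dominated convergence), the left side `(1 - e^{-√m|z|})/|z| - (h(z) - 1)e^{-√m|z|}/|z|` to `√m`.
[cite: LiebSolovej2001, Lemma 3.1 (proof)] -/
theorem integral_clyPhi_zero (hhc : Continuous h) (hhi : Integrable h)
    (hH : Integrable (𝓕 (fun x : Space => (h x : ℂ)))) (heven : ∀ x, h (-x) = h x) (hh0 : h 0 = 1)
    (hmom : Integrable fun q : Space => (1 + ‖q‖ ^ 2) ^ 4 * (𝓕 (fun x : Space => (h x : ℂ)) q).re)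
    (hd : HasFDerivAt h (0 : Space →L[ℝ] ℝ) 0) {m : ℝ} (hm1 : 1 ≤ m) :
    ∫ p, (4 * π / (4 * π ^ 2 * ‖p‖ ^ 2) -
        ∫ q, (𝓕 (fun x : Space => (h x : ℂ)) q).re * (4 * π / (4 * π ^ 2 * ‖p - q‖ ^ 2 + m))) =
      Real.sqrt m := by
  have hm0 : 0 < m := by linarith
  have hΦi := integrable_clyPhi_zero hhc hhi hH heven hh0 hmom hm1
  have hΦm := measurable_clyPhi_zero hhc hhi hH heven hm0
  set Φ₀ : Space → ℝ := fun p => 4 * π / (4 * π ^ 2 * ‖p‖ ^ 2) -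
    ∫ q, (𝓕 (fun x : Space => (h x : ℂ)) q).re * (4 * π / (4 * π ^ 2 * ‖p - q‖ ^ 2 + m)) with hΦ₀
  -- the right-hand side is continuous in `z` at `0`
  have hR : Tendsto (fun z : Space => ∫ p, Φ₀ p * Real.cos (2 * π * ⟪p, z⟫_ℝ)) (𝓝 0)
      (𝓝 (∫ p, Φ₀ p)) := by
    have key : Tendsto (fun z : Space => ∫ p, Φ₀ p * Real.cos (2 * π * ⟪p, z⟫_ℝ)) (𝓝 0)
        (𝓝 (∫ p, Φ₀ p * Real.cos (2 * π * ⟪p, (0 : Space)⟫_ℝ))) := by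
      refine tendsto_integral_filter_of_dominated_convergence (fun p => ‖Φ₀ p‖) ?_ ?_ hΦi.norm ?_
      · exact Eventually.of_forall fun z => (hΦm.mul (Real.continuous_cos.comp
          (continuous_const.mul (continuous_id.inner continuous_const))).measurable).aestronglyMeasurable
      · refine Eventually.of_forall fun z => Eventually.of_forall fun p => ?_
        rw [norm_mul]
        exact mul_le_of_le_one_right (norm_nonneg _)
          (by rw [Real.norm_eq_abs]; exact Real.abs_cos_le_one _)
      · refine Eventually.of_forall fun p => ?_
        exact ((continuous_const.mul (Real.continuous_cos.comp (continuous_const.mul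
          (continuous_const.inner continuous_id)))).tendsto (0 : Space))
    simpa only [inner_zero_right, mul_zero, Real.cos_zero, mul_one] using key
  -- the left-hand side tends to `√m` along `z → 0`, `z ≠ 0`
  have hL : Tendsto (fun z : Space => ‖z‖⁻¹ - h z * (Real.exp (-(Real.sqrt m * ‖z‖)) / ‖z‖))
      (𝓝[≠] 0) (𝓝 (Real.sqrt m)) := by
    set ω := Real.sqrt m with hω
    have hg : HasDerivAt (fun r : ℝ => Real.exp (-(ω * r))) (-ω) 0 := by
      have := (((hasDerivAt_id (0 : ℝ)).const_mul ω).neg).exp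
      simpa using this
    have hT := hg.tendsto_slope_zero_right
    have hT1 : Tendsto (fun r : ℝ => (1 - Real.exp (-(ω * r))) / r) (𝓝[>] 0) (𝓝 ω) := by
      have := hT.neg
      rw [neg_neg] at this
      refine this.congr fun r => ?_
      simp only [zero_add, mul_zero, neg_zero, Real.exp_zero, smul_eq_mul]
      rw [div_eq_mul_inv]
      ring
    have hnorm : Tendsto (fun z : Space => ‖z‖) (𝓝[≠] 0) (𝓝[>] 0) := by
      refine tendsto_nhdsWithin_iff.2 ⟨tendsto_norm_zero.mono_left nhdsWithin_le_nhds, ?_⟩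
      filter_upwards [self_mem_nhdsWithin] with z hz
      exact norm_pos_iff.2 hz
    have hA : Tendsto (fun z : Space => (1 - Real.exp (-(ω * ‖z‖))) / ‖z‖) (𝓝[≠] 0) (𝓝 ω) :=
      hT1.comp hnorm
    have hB : Tendsto (fun z : Space => (h z - 1) / ‖z‖) (𝓝 0) (𝓝 0) := by
      have ho := hasFDerivAt_iff_isLittleO_nhds_zero.1 hd
      have ho' : (fun v : Space => h v - 1) =o[𝓝 (0 : Space)] fun v => v := by
        refine ho.congr' (Eventually.of_forall fun v => ?_) EventuallyEq.rfl
        simp [hh0]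
      exact ho'.norm_right.tendsto_div_nhds_zero
    have hB' : Tendsto (fun z : Space => (h z - 1) / ‖z‖ * Real.exp (-(ω * ‖z‖))) (𝓝 0) (𝓝 0) := by
      have he : Tendsto (fun z : Space => Real.exp (-(ω * ‖z‖))) (𝓝 0) (𝓝 1) := by
        have hc : Continuous fun z : Space => Real.exp (-(ω * ‖z‖)) :=
          Real.continuous_exp.comp (continuous_const.mul continuous_norm).neg
        simpa using hc.tendsto 0
      simpa using hB.mul he
    have hcomb := hA.sub (hB'.mono_left nhdsWithin_le_nhds)
    rw [sub_zero] at hcomb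
    exact hcomb.congr fun z => by ring
  -- the two sides agree for `z ≠ 0`
  have hEq : (fun z : Space => ‖z‖⁻¹ - h z * (Real.exp (-(Real.sqrt m * ‖z‖)) / ‖z‖)) =ᶠ[𝓝[≠] (0 : Space)]
      fun z => ∫ p, Φ₀ p * Real.cos (2 * π * ⟪p, z⟫_ℝ) := by
    filter_upwards [self_mem_nhdsWithin] with z hz
    exact coulomb_sub_smearedYukawa_eq_integral_cos hhc hhi hH heven hh0 hmom hm1 hz
  exact (tendsto_nhds_unique_of_eventuallyEq hL (hR.mono_left nhdsWithin_le_nhds) hEq).symm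

end PartA

/-! ### Part B: the cutoff `h = (∫χ²)⁻¹ χ ∗ χ(-·)` for `χ ∈ C_c^∞` -/

section PartB

variable {χ : Space → ℝ}

/-- `∫ χ(u)χ(u - z) du = (χ ⋆ χ(-·))(z)`. [folklore] -/
theorem autocorr_eq_convolution (χ : Space → ℝ) :
    (fun z : Space => ∫ u, χ u * χ (u - z)) =
      (χ ⋆[ContinuousLinearMap.lsmul ℝ ℝ, volume] fun v : Space => χ (-v)) := by
  funext z
  rw [convolution_lsmul]
  simp only [smul_eq_mul, neg_sub]

/-- The autocorrelation `z ↦ ∫ χ(u)χ(u - z) du` of a smooth compactly supported `χ` is smooth.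
[folklore] -/
theorem contDiff_autocorr (hχ : ContDiff ℝ (⊤ : ℕ∞) χ) (hsupp : HasCompactSupport χ) :
    ContDiff ℝ (⊤ : ℕ∞) fun z : Space => ∫ u, χ u * χ (u - z) := by
  rw [autocorr_eq_convolution χ]
  exact hsupp.contDiff_convolution_left _ hχ
    ((hχ.continuous.comp continuous_neg).locallyIntegrable)

/-- … and compactly supported. [folklore] -/
theorem hasCompactSupport_autocorr (hsupp : HasCompactSupport χ) :
    HasCompactSupport fun z : Space => ∫ u, χ u * χ (u - z) := by
  rw [autocorr_eq_convolution χ]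
  exact hsupp.convolution _ (hsupp.comp_homeomorph (Homeomorph.neg Space))

/-- … and even. [folklore] -/
theorem autocorr_neg (χ : Space → ℝ) (z : Space) :
    ∫ u, χ u * χ (u - -z) = ∫ u, χ u * χ (u - z) := by
  have e := integral_sub_right_eq_self (μ := (volume : Measure Space)) (fun u => χ u * χ (u + z)) z
  simp only [sub_add_cancel] at e
  simp only [sub_neg_eq_add]
  rw [← e]
  refine integral_congr_ae (Eventually.of_forall fun u => ?_)
  simp only
  ring

/-- An even function differentiable at the origin has zero derivative there. [folklore] -/
theorem hasFDerivAt_zero_of_even {f : Space → ℝ} (hf : DifferentiableAt ℝ f 0)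
    (heven : ∀ x, f (-x) = f x) : HasFDerivAt f (0 : Space →L[ℝ] ℝ) 0 := by
  have hd : HasFDerivAt f (fderiv ℝ f 0) 0 := hf.hasFDerivAt
  have hneg : HasFDerivAt (fun x : Space => f (-x))
      ((fderiv ℝ f 0).comp (-ContinuousLinearMap.id ℝ Space)) 0 := by
    have h1 : HasFDerivAt (fun x : Space => -x) (-ContinuousLinearMap.id ℝ Space) 0 :=
      (hasFDerivAt_id (0 : Space)).neg
    have h2 : HasFDerivAt f (fderiv ℝ f 0) (-0 : Space) := by rw [neg_zero]; exact hd
    exact h2.comp (0 : Space) h1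
  have hfun : (fun x : Space => f (-x)) = f := funext heven
  rw [hfun] at hneg
  have huniq := hd.unique hneg
  have hzero : fderiv ℝ f 0 = 0 := by
    ext v
    have e := congrArg (fun L : Space →L[ℝ] ℝ => L v) huniq
    simp at e
    show (fderiv ℝ f 0) v = 0
    linarith [e]
  rw [← hzero]
  exact hd

/-- `(1 + x)⁴ ≤ 8(1 + x⁴)` for `x ≥ 0` (`8(1+x⁴) - (1+x)⁴ = (x-1)²(7x²+10x+7)`). [folklore] -/
theorem one_add_pow_four_le {x : ℝ} (hx : 0 ≤ x) : (1 + x) ^ 4 ≤ 8 * (1 + x ^ 4) := by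
  nlinarith [mul_nonneg (sq_nonneg (x - 1)) (by positivity : (0 : ℝ) ≤ 7 * x ^ 2 + 10 * x + 7)]

/-- **Fourier hypotheses of a smooth compactly supported cutoff**: for `f ∈ C_c^∞(ℝ³)` real,
`𝓕f ∈ L¹` and `(1+|q|²)⁴ Re𝓕f ∈ L¹` (`f` is a Schwartz function, hence so is `𝓕f`).
[folklore] -/
theorem fourier_integrable_of_smooth_compactSupport {f : Space → ℝ} (hf : ContDiff ℝ (⊤ : ℕ∞) f)
    (hsupp : HasCompactSupport f) :
    Integrable (𝓕 (fun x : Space => (f x : ℂ))) ∧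
      Integrable fun q : Space => (1 + ‖q‖ ^ 2) ^ 4 * (𝓕 (fun x : Space => (f x : ℂ)) q).re := by
  have hφc : HasCompactSupport fun x : Space => ((f x : ℝ) : ℂ) := hsupp.comp_left Complex.ofReal_zero
  have hφs : ContDiff ℝ (⊤ : ℕ∞) fun x : Space => ((f x : ℝ) : ℂ) :=
    Complex.ofRealCLM.contDiff.comp hf
  set S : SchwartzMap Space ℂ := hφc.toSchwartzMap hφs with hS
  set FS : SchwartzMap Space ℂ := 𝓕 S with hFS
  have hF : 𝓕 (fun x : Space => (f x : ℂ)) = ⇑FS := by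
    rw [hFS, SchwartzMap.fourier_coe]
    rfl
  refine ⟨?_, ?_⟩
  · rw [hF]
    exact FS.integrable
  · have h0 := FS.integrable_pow_mul volume 0
    have h8 := FS.integrable_pow_mul volume 8
    refine ((h0.add h8).const_mul 8).mono' ?_ (Eventually.of_forall fun q => ?_)
    · rw [hF]
      exact (((continuous_const.add (continuous_norm.pow 2)).pow 4).mul
        (Complex.continuous_re.comp FS.continuous)).aestronglyMeasurable
    · rw [hF, norm_mul, Real.norm_of_nonneg (by positivity : (0 : ℝ) ≤ (1 + ‖q‖ ^ 2) ^ 4),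
        Real.norm_eq_abs]
      simp only [Pi.add_apply, pow_zero, one_mul]
      have hre : |(FS q).re| ≤ ‖FS q‖ := Complex.abs_re_le_norm _
      have hw : (1 + ‖q‖ ^ 2) ^ 4 ≤ 8 * (1 + ‖q‖ ^ 8) := by
        have := one_add_pow_four_le (sq_nonneg ‖q‖)
        calc (1 + ‖q‖ ^ 2) ^ 4 ≤ 8 * (1 + (‖q‖ ^ 2) ^ 4) := this
          _ = 8 * (1 + ‖q‖ ^ 8) := by ring
      have hn : 0 ≤ ‖FS q‖ := norm_nonneg _
      calc (1 + ‖q‖ ^ 2) ^ 4 * |(FS q).re| ≤ 8 * (1 + ‖q‖ ^ 8) * ‖FS q‖ :=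
            mul_le_mul hw hre (abs_nonneg _) (by positivity)
        _ = 8 * (‖FS q‖ + ‖q‖ ^ 8 * ‖FS q‖) := by ring

/-- **The Conlon–Lieb–Yau decomposition of the Coulomb potential** [ConlonLiebYau1988,
Lemma 2.1, case `ν = 0`; quoted in LiebSolovej2001, §3 and LSSY2005, remark after Thm. 10.5]:
let `χ ∈ C_c^∞(ℝ³)` be real with `∫ χ² ≠ 0` and put `h(z) = (∫χ²)⁻¹ ∫ χ(u)χ(u - z) du`
(`= γ χ ∗ χ(-·)`, so `h(0) = 1`, `h` even, smooth, compactly supported). Then there is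
`ω₀ = ω₀(χ) > 0` such that for every `ω ≥ ω₀` the kernel `|z|⁻¹ - h(z) e^{-ω|z|}/|z|` is of
positive type with value `ω` at the origin: there is `Φ ≥ 0`, measurable and integrable, with
`∫ Φ = ω` and `|z|⁻¹ = ∫ Φ(p) cos(2π⟨p, z⟩) dp + h(z) e^{-ω|z|}/|z|` for all `z ≠ 0`.
(The source assumes only `h ∈ C⁴`.) [cite: ConlonLiebYau1988, Lemma 2.1] -/
theorem cly_coulomb_decomposition (hχ : ContDiff ℝ (⊤ : ℕ∞) χ) (hsupp : HasCompactSupport χ)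
    (hχ0 : (∫ u, χ u ^ 2) ≠ 0) :
    ∃ ω₀ : ℝ, 0 < ω₀ ∧ ∀ ω : ℝ, ω₀ ≤ ω → ∃ Φ : Space → ℝ, Measurable Φ ∧ Integrable Φ ∧
      (∀ p, 0 ≤ Φ p) ∧ (∫ p, Φ p) = ω ∧ ∀ z : Space, z ≠ 0 → ‖z‖⁻¹ =
        (∫ p, Φ p * Real.cos (2 * π * ⟪p, z⟫_ℝ)) +
          ((∫ u, χ u ^ 2)⁻¹ * ∫ u, χ u * χ (u - z)) * (Real.exp (-(ω * ‖z‖)) / ‖z‖) := by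
  have hπ : 0 < π := Real.pi_pos
  set h : Space → ℝ := fun z => (∫ u, χ u ^ 2)⁻¹ * ∫ u, χ u * χ (u - z) with hdef
  -- the hypotheses of Part A for `h`
  have hhs : ContDiff ℝ (⊤ : ℕ∞) h := contDiff_const.mul (contDiff_autocorr hχ hsupp)
  have hhc : Continuous h := hhs.continuous
  have hhsupp : HasCompactSupport h := (hasCompactSupport_autocorr hsupp).mul_left
  have hhi : Integrable h := hhc.integrable_of_hasCompactSupport hhsupp
  have heven : ∀ x, h (-x) = h x := fun x => by simp only [hdef, autocorr_neg]
  have hh0 : h 0 = 1 := by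
    simp only [hdef, sub_zero]
    have e : (fun u : Space => χ u * χ u) = fun u => χ u ^ 2 := funext fun u => (sq (χ u)).symm
    rw [e, inv_mul_cancel₀ hχ0]
  obtain ⟨hH, hmom⟩ := fourier_integrable_of_smooth_compactSupport hhs hhsupp
  have hd : HasFDerivAt h (0 : Space →L[ℝ] ℝ) 0 :=
    hasFDerivAt_zero_of_even ((hhs.differentiable (by simp)).differentiableAt) heven
  -- the constants
  set A : ℝ := ∫ q, (6 * ‖q‖ ^ 2 + 4 * π ^ 2 * ‖q‖ ^ 4) *
    |(𝓕 (fun x : Space => (h x : ℂ)) q).re| with hAdef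
  set B : ℝ := ∫ q, (6 * ‖q‖ ^ 2 + 4 * π ^ 2 * ‖q‖ ^ 4) * (1 + 4 * ‖q‖ ^ 2) ^ 2 *
    |(𝓕 (fun x : Space => (h x : ℂ)) q).re| with hBdef
  have hA0 : 0 ≤ A := integral_nonneg fun q => by positivity
  have hB0 : 0 ≤ B := integral_nonneg fun q => by positivity
  refine ⟨max (2 * π) (max (Real.sqrt (32 * π ^ 2 * A + 1)) (Real.sqrt (16 * π ^ 2 * B + 1))),
    lt_max_of_lt_left (by positivity), fun ω hω => ?_⟩
  obtain ⟨h2π, hω'⟩ := max_le_iff.1 hω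
  obtain ⟨hωA, hωB⟩ := max_le_iff.1 hω'
  have hω0 : 0 < ω := lt_of_lt_of_le (by positivity) h2π
  set m : ℝ := ω ^ 2 with hmdef
  have hm : 4 * π ^ 2 ≤ m := by
    have := pow_le_pow_left₀ (by positivity) h2π 2
    calc 4 * π ^ 2 = (2 * π) ^ 2 := by ring
      _ ≤ ω ^ 2 := this
  have hm1 : 1 ≤ m := le_trans (by nlinarith [Real.two_le_pi]) hm
  have hm0 : 0 < m := by linarith
  have hAm : 32 * π ^ 2 * A + 1 ≤ m := by
    have := pow_le_pow_left₀ (Real.sqrt_nonneg _) hωA 2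
    rwa [Real.sq_sqrt (by positivity)] at this
  have hBm : 16 * π ^ 2 * B + 1 ≤ m := by
    have := pow_le_pow_left₀ (Real.sqrt_nonneg _) hωB 2
    rwa [Real.sq_sqrt (by positivity)] at this
  have hsq : Real.sqrt m = ω := Real.sqrt_sq hω0.le
  -- `Φ₀` and `Φ = max Φ₀ 0`
  set Φ₀ : Space → ℝ := fun p => 4 * π / (4 * π ^ 2 * ‖p‖ ^ 2) -
    ∫ q, (𝓕 (fun x : Space => (h x : ℂ)) q).re * (4 * π / (4 * π ^ 2 * ‖p - q‖ ^ 2 + m)) with hΦ₀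
  have hΦ₀m : Measurable Φ₀ := measurable_clyPhi_zero hhc hhi hH heven hm0
  have hΦ₀i : Integrable Φ₀ := integrable_clyPhi_zero hhc hhi hH heven hh0 hmom hm1
  have hΦ₀nn : ∀ p : Space, p ≠ 0 → 0 ≤ Φ₀ p := fun p hp =>
    clyPhi_zero_nonneg hhc hhi hH heven hh0 hmom hm hAm hBm hp
  have hae : (fun p => max (Φ₀ p) 0) =ᵐ[volume] Φ₀ := by
    filter_upwards [ae_ne_zero_space] with p hp
    exact max_eq_left (hΦ₀nn p hp)
  refine ⟨fun p => max (Φ₀ p) 0, hΦ₀m.max measurable_const, hΦ₀i.congr hae.symm,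
    fun p => le_max_right _ _, ?_, fun z hz => ?_⟩
  · rw [integral_congr_ae hae, ← hsq]
    exact integral_clyPhi_zero hhc hhi hH heven hh0 hmom hd hm1
  · have hcos : ∫ p, max (Φ₀ p) 0 * Real.cos (2 * π * ⟪p, z⟫_ℝ) =
        ∫ p, Φ₀ p * Real.cos (2 * π * ⟪p, z⟫_ℝ) := by
      refine integral_congr_ae ?_
      filter_upwards [hae] with p hp
      rw [hp]
    have hrep : ∫ p, Φ₀ p * Real.cos (2 * π * ⟪p, z⟫_ℝ) =
        ‖z‖⁻¹ - h z * (Real.exp (-(Real.sqrt m * ‖z‖)) / ‖z‖) :=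
      (coulomb_sub_smearedYukawa_eq_integral_cos hhc hhi hH heven hh0 hmom hm1 hz).symm
    rw [hcos, hrep, hsq]
    simp only [hdef]
    ring

/-- **The Conlon–Lieb–Yau inequality for point charges** [ConlonLiebYau1988, Lemma 2.1, `ν = 0`]:
with `χ`, `h`, `ω₀` as in `cly_coulomb_decomposition`, for `ω ≥ ω₀`, distinct points
`x₁, …, x_N` and real charges `eᵢ`,
`∑_{i<j} eᵢeⱼ (|xᵢ - xⱼ|⁻¹ - h(xᵢ - xⱼ) e^{-ω|xᵢ - xⱼ|}/|xᵢ - xⱼ|) ≥ -½ ω ∑ᵢ eᵢ²`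
(for `eᵢ = ±1` the right side is `-½ωN`). [cite: ConlonLiebYau1988, Lemma 2.1] -/
theorem cly_point_charges (hχ : ContDiff ℝ (⊤ : ℕ∞) χ) (hsupp : HasCompactSupport χ)
    (hχ0 : (∫ u, χ u ^ 2) ≠ 0) :
    ∃ ω₀ : ℝ, 0 < ω₀ ∧ ∀ ω : ℝ, ω₀ ≤ ω → ∀ {N : ℕ} {X : Fin N → Space}, Function.Injective X →
      ∀ e : Fin N → ℝ,
        -(1 / 2 * ω * ∑ i, e i ^ 2) ≤ ∑ i, ∑ j with i < j, e i * e j *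
          (‖X i - X j‖⁻¹ - ((∫ u, χ u ^ 2)⁻¹ * ∫ u, χ u * χ (u - (X i - X j))) *
            (Real.exp (-(ω * ‖X i - X j‖)) / ‖X i - X j‖)) := by
  obtain ⟨ω₀, hω₀, H⟩ := cly_coulomb_decomposition hχ hsupp hχ0
  refine ⟨ω₀, hω₀, fun ω hω N X hX e => ?_⟩
  obtain ⟨Φ, hΦm, hΦi, hΦ0, hΦint, hF⟩ := H ω hω
  have h0 := positiveType_points_ge hΦm hΦi hΦ0 e X (g := fun _ : Space => (0 : ℝ))
    measurable_const (integrable_zero _ _ _)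
  simp only [zero_mul, integral_zero, mul_zero, Finset.sum_const_zero, sub_zero, add_zero,
    hΦint] at h0
  refine h0.trans (le_of_eq ?_)
  refine Finset.sum_congr rfl fun i _ => Finset.sum_congr rfl fun j hj => ?_
  have hij : i < j := (Finset.mem_filter.1 hj).2
  have hF' := hF (X i - X j) (sub_ne_zero.2 (hX.ne hij.ne))
  rw [hF']
  ring

/-- **The sliding lemma for point charges, unconditionally** [LSSY2005, Thm. 10.5]: for
`χ ∈ C_c^∞(ℝ³)` real with `∫χ² ≠ 0` there is `ω₀(χ) > 0` such that for all `ω ≥ ω₀`, distinct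
points `xᵢ` and real charges `eᵢ`, with `Y_ω(x) = e^{-ω|x|}/|x|`,
`(∫χ²)⁻¹ ∫ ∑_{i<j} eᵢeⱼ χ(xᵢ - z) Y_ω(xᵢ - xⱼ) χ(xⱼ - z) dz - ½ ω ∑ᵢ eᵢ² ≤ ∑_{i<j} eᵢeⱼ|xᵢ - xⱼ|⁻¹`.
[cite: LSSY2005, Thm. 10.5] -/
theorem sliding_lemma_pp_cly (hχ : ContDiff ℝ (⊤ : ℕ∞) χ) (hsupp : HasCompactSupport χ)
    (hχ0 : (∫ u, χ u ^ 2) ≠ 0) :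
    ∃ ω₀ : ℝ, 0 < ω₀ ∧ ∀ ω : ℝ, ω₀ ≤ ω → ∀ {N : ℕ} {X : Fin N → Space}, Function.Injective X →
      ∀ e : Fin N → ℝ,
        (∫ u, χ u ^ 2)⁻¹ * (∫ z : Space, ∑ i, ∑ j with i < j,
            e i * e j * (χ (X i - z) * (Real.exp (-(ω * ‖X i - X j‖)) / ‖X i - X j‖) * χ (X j - z))) -
          1 / 2 * ω * ∑ i, e i ^ 2 ≤
        ∑ i, ∑ j with i < j, e i * e j * ‖X i - X j‖⁻¹ := by
  obtain ⟨ω₀, hω₀, H⟩ := cly_coulomb_decomposition hχ hsupp hχ0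
  refine ⟨ω₀, hω₀, fun ω hω N X hX e => ?_⟩
  obtain ⟨Φ, hΦm, hΦi, hΦ0, hΦint, hF⟩ := H ω hω
  have h := sliding_lemma_pp hχ.continuous hsupp (fun x : Space => Real.exp (-(ω * ‖x‖)) / ‖x‖)
    hΦm hΦi hΦ0 hF hX e
  rwa [hΦint] at h

/-- **Lieb–Solovej's sliding lemma for jellium, unconditionally** [LiebSolovej2001, Lemma 3.1]
(scale `ℓ = 1`): for `χ ∈ C_c^∞(ℝ³)` real with `∫χ² ≠ 0` there is `ω₀(χ) > 0` such that for all
`ω ≥ ω₀`, distinct points `x₁, …, x_N`, and every measurable integrable background `g` with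
finite particle–background and background–background `Y_ω`-energies, with
`w_z(x, y) = χ(x - z) Y_ω(x - y) χ(y - z)`, `Y_ω(x) = e^{-ω|x|}/|x|`,
`(∫χ²)⁻¹ ∫ [∑_{i<j} w_z(xᵢ,xⱼ) - ∑ᵢ ∫ g(y) w_z(xᵢ,y) dy + ½∬ g g w_z] dz - ½ ω N
 ≤ ∑_{i<j}|xᵢ - xⱼ|⁻¹ - ∑ᵢ ∫ g(y)|xᵢ - y|⁻¹ dy + ½∬ g(x)g(y)|x - y|⁻¹`.
[cite: LiebSolovej2001, Lemma 3.1] -/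
theorem sliding_lemma_jellium_cly (hχ : ContDiff ℝ (⊤ : ℕ∞) χ) (hsupp : HasCompactSupport χ)
    (hχ0 : (∫ u, χ u ^ 2) ≠ 0) :
    ∃ ω₀ : ℝ, 0 < ω₀ ∧ ∀ ω : ℝ, ω₀ ≤ ω → ∀ {N : ℕ} {X : Fin N → Space}, Function.Injective X →
      ∀ {g : Space → ℝ}, Measurable g → Integrable g →
        (∀ i, Integrable fun y : Space => g y * (Real.exp (-(ω * ‖X i - y‖)) / ‖X i - y‖)) →
        Integrable (fun q : Space × Space => g q.1 * g q.2 *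
          (Real.exp (-(ω * ‖q.1 - q.2‖)) / ‖q.1 - q.2‖)) (volume.prod volume) →
        (∫ u, χ u ^ 2)⁻¹ * (∫ z : Space,
            ((∑ i, ∑ j with i < j,
                χ (X i - z) * (Real.exp (-(ω * ‖X i - X j‖)) / ‖X i - X j‖) * χ (X j - z)) -
              (∑ i, ∫ y, g y * (χ (X i - z) * (Real.exp (-(ω * ‖X i - y‖)) / ‖X i - y‖) *
                χ (y - z))) +
              1 / 2 * ∫ q : Space × Space, g q.1 * g q.2 * (χ (q.1 - z) *
                (Real.exp (-(ω * ‖q.1 - q.2‖)) / ‖q.1 - q.2‖) * χ (q.2 - z)) ∂(volume.prod volume))) -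
          1 / 2 * ω * N ≤
        (∑ i, ∑ j with i < j, ‖X i - X j‖⁻¹) - (∑ i, ∫ y, g y * ‖X i - y‖⁻¹) +
          1 / 2 * ∫ q : Space × Space, g q.1 * g q.2 * ‖q.1 - q.2‖⁻¹ ∂(volume.prod volume) := by
  obtain ⟨ω₀, hω₀, H⟩ := cly_coulomb_decomposition hχ hsupp hχ0
  refine ⟨ω₀, hω₀, fun ω hω N X hX g hgm hg hgY hggY => ?_⟩
  obtain ⟨Φ, hΦm, hΦi, hΦ0, hΦint, hF⟩ := H ω hω
  have hYm : Measurable fun x : Space => Real.exp (-(ω * ‖x‖)) / ‖x‖ :=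
    (Real.measurable_exp.comp (measurable_const.mul measurable_norm).neg).div measurable_norm
  have h := sliding_lemma_jellium hχ.continuous hsupp hYm hΦm hΦi hΦ0 hF hX hgm hg hgY hggY
  rwa [hΦint] at h

end PartB

end Literature.MathematicalPhysics.QuantumManyBody.Coulomb
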